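import Summits.BirchSwinnertonDyer.BirchSwinnertonDyer.Theorems.ByReductionTypeAtTwoRankOneAtTwoOneDoorLawFirstLayerDefs
import Literature.NumberTheory.EllipticCurves.CongruenceNumber
import Literature.NumberTheory.EllipticCurves.ModularSymbolsLattice
import Literature.NumberTheory.EllipticCurves.Selmer
import Literature.NumberTheory.EllipticCurves.QuadraticTwist
import HarnessLib

/-!
# ES-33 «THE TWIST LATTICE in the congruence number at square level, and the anatomy of the 2-adic modular-degree floor» (-es g24, MEMO-es §33; typer -ty g20)

PORT (typer -ty g20, cell bsd-f1-sign2) of -es g24's crux workfile `Cruxes/RankOneAtTwoBigImageOddLocal/TwistLatticeES33.lean` (07ba41998bc5acbc, commit 1abad79acad8,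
284 l., `lean check` rc 0 / 0 sorry, 0 instances / notation, 10/10 crux probes CLEAN), same namespace as the ES-32 precedent (`…Theorems.RankOneAtTwo…`, the workfile is not a
Theses decl).  DEFINITIONS and PROP ROWS VERBATIM (builder-checked block by block; the one malformed citation tag of ES-33A¹ normalised), `@[conjecture]` tags exactly as
-es set them: counting functions `oddSquareCount`, `twoAdicTwistRank` (`a₂(N) = [2⁴ ∣ N] + [2⁶ ∣ N]`), `squareLevelTwistRank` (`a₀(N)`), `primeCount` (`ω(N)`), `primeStar`
(`p*`), `conductorFloorExtra` (`F(v) = [v ≥ 3]·(v − 1)`), `TwoTorsionUnramifiedAtTwo W`; PLAIN rows (theorem-grade / print): **ES-33A₁** `EvenCongruenceNumberAtSquareLevel`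
(IN PRINT, Yazdani 2011), **ES-33A** `TwistLatticeDividesCongruenceNumber` (`2^{a₀(N)} ∣ r_f`, to be PROVED), **ES-33A♯** `DeepTwistDividesCongruenceNumber` (resolvent direction,
one more power of 2), **ES-33A⁰** `SignedTwistLatticeLemma` (the abstract lattice lemma over the tree's congruence-number API — «PROVABLE NOW», support item for a prover),
**ES-33A¹** `AdmissibleTwistsExist` (print-grade: Shimura 3.64 + strong multiplicity one); `@[conjecture]` rows: **ES-33B** `CongruenceNumberSelmerALFloor`, **ES-33E**
`CongruenceNumberConductorFloor` (the r-currency MASTER LAW), **ES-33C** `DipIsCongruenceDefectAtFour`, **ES-33D** `NoDipWhenRamifiedAtTwo`, slice row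
`TwistALMinimalCongruenceSelmerTrivialOnSlice`.  -es's glue theorems (`even_of_twistLattice`, `twistLattice_dvd_of_deep`, `twoAdicTwistRank_le_extra`, `sliceTrivial_of_floor`,
`twistLattice_of`) and REF1's probes go to the kernel sibling `TwistLatticeAtTwoKernel.lean`; the workfile's five `native_decide` level evaluations are not ported (two are
re-proved kernel-side without `native_decide`).

PORT GATE = REF1-AUDIT §256 (-ref1 g22, 2026-08-29 ~21:40Z; `REF1-data/b256/`: Probe256.lean 528a16f1f219529d rc 0, fold256.py / fold256.out — an INDEPENDENT re-fold from the
Cremona a-invariants, 38 042 curves; r_E imported from ENGINE 33P): **ES-33A⁰ SURVIVES (theorem-grade; elementary; provable in-tree from `dvd_congruenceNumber_of_sub_eq_smul`);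
ES-33A SURVIVES (theorem-grade; paper proof re-derived; census 4 125/4 125, equality 90; `¬HasCM` load-bearing: 8 CM violators); ES-33A♯ SURVIVES (theorem-grade; re-derived; 90/90,
equality 2; the clause at 2 is load-bearing — dropping it is refuted by the orbit 1323e1/g1/k1/l1 exactly as -es found; the odd-multiplicative split clause is NOT exercised by the
data, 121/121 without it — R256a); ES-33B / ES-33E / ES-33C / ES-33D SURVIVE as `@[conjecture]` rows — every census count of CensusES33 §4 reproduced EXACTLY ((C3) E: 2 518/2 518,
equalities by `v` = 225/374/149/68/59/24/4 on populations 803/994/290/163/170/50/48; (C4) B: 2 518/2 518, at `4 ∥ N` 299/299 tight 154; (C5) C: `S₃` `v₂ r ≤ v₂ m + 1` 299/299,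
dips with defect 1: 41/41; (C6) D: no dip when ramified 1 421/1 421, tight 311; 150/150 dips unramified; (C0) `m ∣ r` 4 179/4 179, ARS at 2 4 179/4 179); ES-33A¹ print-grade;
glue kernel-checked.**  Hypothesis mutations: `¬CM` (A) necessary; clause at 2 (A♯) necessary; odd-multiplicative split clause (A♯) unexercised; `S₃` (B/E) necessary (6 `C₃`
curves one below); ramified-at-2 (D) necessary; optimality not testable.  Riders: **R256a** (folded into the A♯ docstring), **R256b** (to -es: the typed A♯ omits the 2-adic
deep directions `D ∈ {−4 (16 ∣ N), ±8 (64 ∣ N)}` with `D·Δ ∈ ℚ²`: 48/48 satisfy `2^{a₀+1} ∣ r` — candidate row A♯₂), **R256c** (placement of B/E vs Agashe–Ribet–Stein and the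
Atkin–Lehner-sign literature is REF2's call).  PARTITION: none (no C1/C2/C3′ restatement; the r-currency rows feed the 23715 slice only through `sliceTrivial_of_floor`);
beyond-print theorem: no (A/A♯ print-grade consequences of Shimura 3.64 + Ribet's congruence module; B–E conjectures); bears_on stmt-23715 via the slice row.

REF2 PLACEMENT (-ref2 g58, 2026-08-29T21:32:28Z): (1) the DICTIONARY «`ad⁰ρ̄ = sl₂(𝔽₂) ⊇ E[2]`; `H¹(ℚ, ad⁰ρ̄) = Hom(G_ℚ, 𝔽₂) ⊕ H¹(ℚ, E[2])` = (infinitesimal quadratic twists) ⊕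
(Selmer-type classes)» is PRINT — [cite: Dummigan2006, §1] (the squaring map `E[2] → Sym²E[2]` carries `Sel₂(E)` into a Selmer group of `H¹(ℚ, Sym²E[2])` = reduced tangent
space of a 2-adic deformation ring ↔ Hecke ring ↔ modular degree; «the heart of the difficulty is the reducibility of `Sym²E[2]`»; Watkins himself proposed the Atkin–Lehner
strengthening = the ancestry of the `ω(N) − 1` term); (2) ES-33A: elementary theorem-candidate («provable now» — agree); nearest print [cite: DummiganKrishnamoorthy2013]
(paywalled, acq-02291 — cannot rule out that the twist count is there; cite as nearest) and [cite: Yazdani2011OddModularDegree, Prop. 2.10] (the parity case): grade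
corollary-level / folklore-adjacent, LAND IT; ES-33A♯: beyond print, small theorem-candidate (transposition ⟹ trace 0 is CFT; the mod-4 lift is the content); (3) ES-33E MASTER
LAW = WATKINS' conjecture family ([cite: Watkins2002, Conj. 4.1]; the `#Sel₂`-and-Atkin–Lehner strengthening as reported by Dummigan) in CONGRUENCE-NUMBER currency +
[cite: AgasheRibetStein2012, Conj. 2.2] at 2 + an explicit additive-at-2 term `(v − 1)` — the additive term and the r-currency exactness are NOT in print (Česnavičius–Neururer–Saha
2022 bound the Manin constant BY `v_p(deg φ)`, no lower bound on `deg` from additive `p`) ⟹ conjecture, NEW-COMBINATION; (4) ES-33C / ES-33D / P33.11 (`4 ∥ N` dips = congruence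
defects `v₂(r/m) = 1` exactly on `S₃` with `E[2]` UNRAMIFIED at 2; ramified ⟹ no dip): beyond print; nearest: ARS Prop. 5.1 (= [cite: KilfordWiese2008, Thm. 1.7]: `p ∣ r_E`,
`p ∤ m_E` ⟹ multiplicity one fails for `𝔪 = Ann E[p]`) and the `p ∤ N` shape Kilford–Wiese Thm 1.2/1.3 — the «unramified at 2» criterion at `4 ∥ N` is the level-`4M` analogue
with no printed counterpart found ⟹ conjecture-grade beyond print.  PARTITION: none moved; ES-33A → land as theorem (corollary-level); beyond-print theorem landed: none; BSD
not proved.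

DATA (-es g24, `data-es/g24/`, `CensusES33.md` in the crux folder): ENGINE 33 / 33P / 33L (kit job33, j335842, j335549, j335538, j335675; Sage j335426, PARI j335594/j335572).
BSD is not proved by anything here; 23715 is not closed by anything here.

v2 ADDENDUM (typer -ty g21): + `import Literature.NumberTheory.EllipticCurves.QuadraticTwist` and the APPENDED row ES-33F `CongruenceNumberTwistInvariant` (PLAIN `def`; -es g24
addendum 2026-08-30, crux workfile v2 c5c258e7def98a9e l.284–313 VERBATIM; CensusES33 §10–§11: `r_{W ⊗ χ_d} = r_W` for conductor-preserving quadratic twists, 1 389/1 389 pairs,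
the mechanism of the 26 Agashe–Ribet–Stein-2.2 counterexamples at `p = 2`); every v1 declaration byte-identical (p747106).  PORT GATE (ES-33F) = REF1-AUDIT §288 (2026-08-30T01:31:21Z): **SURVIVES,
UPGRADED TO THEOREM-GRADE (elementary; REF1 proof sketch K288.3 under `m² ∣ N`, automatic for conductor-preserving twists)**; R288a re-tag SUPPORT theorem-candidate, R288c verbatim
/ no `@[conjecture]` — honoured; glue `dvd_congruenceNumber_of_twist` to the kernel sibling v2.  REF2 placement owed (R288b input: folklore-grade).  PARTITION none; beyond-print theorem
(kernel): no.

v3 ADDENDUM (typer -ty g21): APPENDED -es g24's ADDENDUM 3 (ES-33A♯ in GENERAL RESOLVENT FORM: (R) `ResolventTwistDividesCongruenceNumber`, (A♯₂)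
`TwoAdicDeepTwistDividesCongruenceNumber`) and ADDENDUM 4 (the odd-`ℓ` twin: (Gℓ) `OddTwistStabiliserDividesCongruenceNumber`, (T) `ModThreeReducibleTraceVanishing`
(print fact shape), (G₃) `ThreeIsogenyTwistDividesCongruenceNumber`) from the crux workfile `Cruxes/RankOneAtTwoBigImageOddLocal/TwistLatticeES33.lean` v4
(8667786b017bfee1, l.312–512) — section docstrings, bodies and docstrings VERBATIM, all PLAIN `def` (theorem-grade targets / print fact; REF1 §301 R301d «plain defs»), riders =
REF1 §301 (verdicts R/A♯₂/Gℓ/T/G₃ SURVIVE, independent re-tally, R301a–b); the five glue theorems (`twoAdicDeep_of_resolvent`, `deepTwist_of_resolvent`,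
`jacobiSym_neg_three_of_mod_three_eq_one/_two`, `threeIsogenyTwist_of_oddStabiliser`) and REF1's Probe301 sanity block go to the kernel sibling v3.  REF2 placement owed.
BSD is not proved; 23715 is not closed; nothing here is a theorem beyond print.

v4 ADDENDUM (typer -ty g22): APPENDED -es g24's ADDENDUM 5 (ENGINE 33N: the SHARP clause at 2 of the resolvent statement — (R♯) `ResolventTwistDividesCongruenceNumberSharp`;
the 4-adic extra depth — (I) `NonsplitCartanFourTwistDividesCongruenceNumber`) from the crux workfile `Cruxes/RankOneAtTwoBigImageOddLocal/TwistLatticeES33.lean`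
(41d37d025705b01d, l.514–580) — section docstrings, bodies and docstrings VERBATIM, PLAIN `def` (statement only), riders = REF1 §311 (R♯ SURVIVES theorem-grade; I SURVIVES with riders R311a p = 2 blind spot / R311b census 10 + mutation witnesses; R311c port);
the glue theorem `sharp_imp_resolvent_minimal` ((R♯) ⟹ (R) for globally minimal models) and REF1's Probe311 block go to the kernel sibling v5.  ALSO (T)
`ModThreeReducibleTraceVanishing` is now DISCHARGED (Literature `EllipticCurves/ReducibleModThreeFrobeniusTrace.lean` p759212 + kernel v4 p759490
`modThreeReducibleTraceVanishing_holds`, `threeIsogenyTwist_of_oddStabiliser'`).  ERRATUM to the v3 paragraph above: of the two Jacobi lemmas only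
`jacobiSym_neg_three_of_mod_three_eq_one` went to the kernel — `…_eq_two` is the landed `SylvesterCorner.jacobiSym_neg_three_eq_neg_one` (gate `dedup.landed`, p757955).
REF2 placement owed.
BSD is not proved; 23715 is not closed; nothing here is a theorem beyond print.

v5 ADDENDUM (typer -ty g22): APPENDED -es g25's v6 block (crux workfile `TwistLatticeES33.lean` 56e746de48b91890, l.581–612, pure append over v5): (I♯)
`NonsplitCartanFourTwistDividesCongruenceNumberSharp` = ES-33I + REF1 §311 R311a's clause `(¬ 2 ∣ N → m % 8 = 5 → a₂ = 0)` (the inert-2 blind spot), section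
docstring + body + docstring VERBATIM, PLAIN; glue `nonsplitCartanFourSharp_of_nonsplit` (I ⟹ I♯) → kernel sibling v6.  REF1-successor gate + REF2 placement owed.
BSD is not proved; 23715/22298 not closed; nothing here is a theorem beyond print.
-/

open scoped Classical AddSubgroup

noncomputable section

set_option linter.dupNamespace false
set_option autoImplicit false

namespace Summit.BirchSwinnertonDyer.BirchSwinnertonDyer.Theorems.RankOneAtTwoTwistLattice

open Literature.NumberTheory.EllipticCurves Literature.NumberTheory.EllipticCurves.ModularForms WeierstrassCurve

/-- `#{p odd prime : p² ∣ N}` — the odd primes at which a quadratic twist of conductor `p` keeps level `N`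
(Shimura 1971 Prop. 3.64: `f ⊗ χ ∈ S₂(Γ₀(lcm(N, cond(χ)²)))`). -/
def oddSquareCount (N : ℕ) : ℕ := (N.primeFactors.filter (fun p => p ≠ 2 ∧ p ^ 2 ∣ N)).card

/-- The `2`-adic twist rank `[2⁴ ∣ N] + [2⁶ ∣ N]`: the characters `χ₋₄` (conductor `4`) and `χ_{±8}` (conductor `8`)
act on `S₂(Γ₀(N))` when `16 ∣ N`, resp. `64 ∣ N`. -/
def twoAdicTwistRank (N : ℕ) : ℕ := (if 2 ^ 4 ∣ N then 1 else 0) + (if 2 ^ 6 ∣ N then 1 else 0)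

/-- `a₀(N) = #{p odd : p² ∣ N} + [2⁴ ∣ N] + [2⁶ ∣ N]`, the rank of the group of quadratic Dirichlet characters `χ`
with `cond(χ)² ∣ N` (the «square-level twist lattice»). -/
def squareLevelTwistRank (N : ℕ) : ℕ := oddSquareCount N + twoAdicTwistRank N

/-- **ES-33A₁ (IN PRINT, parity): a non-CM elliptic newform at a level divisible by an odd square or by `16` has EVEN
congruence number.**  Yazdani, *Modular abelian varieties of odd modular degree*, Algebra & Number Theory 5 (2011),
proof of Prop. 2.10: `χ ⊗ f ∈ S₂(Γ₀(N))` for the quadratic `χ` of conductor `p` when `p^{2+δ_p} ∣ N` (`δ₂ = 2`), and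
`χ ⊗ f ≡ f` modulo `2`; for `E/ℚ` without CM `χ ⊗ f ≠ f`, so `2 ∣ r_f`.  Filed here as the shape of the Literature fact
the lens asks for (D-es-94). [cite: Yazdani2011OddModularDegree, Prop. 2.10 (proof)]
(RIDER, typer -ty g20: PLAIN, IN PRINT (ES-33A₁).  REF1-AUDIT §256: print-grade parity case; follows from ES-33A (kernel `even_of_twistLattice`).  REF2: [cite: Yazdani2011OddModularDegree, Prop. 2.10].) -/
def EvenCongruenceNumberAtSquareLevel : Prop :=
  ∀ (W : WeierstrassCurve ℚ) [W.IsElliptic] [NeZero (W.conductorNorm ℤ)]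
    (D : ModularParametrizationData W (W.conductorNorm ℤ)), ¬ W.HasCM →
    0 < squareLevelTwistRank (W.conductorNorm ℤ) → 2 ∣ congruenceNumber D.f

/-- **ES-33A `TwistLatticeDividesCongruenceNumber` (this lens; elementary, to be PROVED — not a conjecture): the square-level
twist lattice divides the congruence number, `2^{a₀(N)} ∣ r_f`.**  Proof sketch (MEMO-es §33.2): for independent quadratic
characters `χ₁ … χ_k` with `cond(χᵢ)² ∣ N`, all `2^k` twists `f ⊗ χ_S` lie in `S₂(Γ₀(N); ℤ)`, are Petersson-orthogonal to `f`
for `S ≠ ∅` (distinct eigen-packets, `E` non-CM), and `h = 2^{-k} Σ_n a_n ∏ᵢ (1 − χᵢ(n)) qⁿ = 2^{-k} Σ_S (−1)^{|S|} f ⊗ χ_S` has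
INTEGER coefficients (`∏(1 − χᵢ(n)) ∈ {0, 2^k}` for `(n, N') = 1`, and `a_n = 0` when `n` shares a prime with some `cond χᵢ`,
those primes being additive for `E`); then `f − g = 2^k h` with `g = f − 2^k h ∈ (ℤf)^⊥`, and `dvd_congruenceNumber_of_sub_eq_smul`
gives `2^k ∣ congruenceNumber f`.  ENGINE 33 (kit job33) checks it numerically on every congruence number computed.
Why it might fail: only through a gap in the orthogonality / integrality bookkeeping at the primes dividing `cond χ`.
(RIDER, typer -ty g20: PLAIN theorem-target (ES-33A), not a conjecture.  REF1-AUDIT §256: **SURVIVES, theorem-grade** — paper proof re-derived (BC7 (i): `cond(χ_{p*})² = p² ∣ N ⟹ f ⊗ χ ∈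
S₂(Γ₀(N))` by Shimura 3.64 with `M = N`; `f ⊗ χ_S ≠ f` for `S ≠ ∅` for non-CM `f`; integrality of `h`; then the tree lemma); independent census (C1) 4 125/4 125 non-CM, equality 90;
mutation «drop `¬CM`»: 8 CM violators (27a1, 32a1, 36a1, 49a1, 243b1, 1323b1, …) — the hypothesis is load-bearing.  REF2 (21:32Z): elementary theorem-candidate, «provable
now» — agree; nearest print [cite: DummiganKrishnamoorthy2013] (paywalled, acq-02291) and Yazdani 2011; grade corollary-level / folklore-adjacent — LAND IT (a prover's item:
kernel `twistLattice_of` reduces it to ES-33A⁰ + ES-33A¹).) -/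
def TwistLatticeDividesCongruenceNumber : Prop :=
  ∀ (W : WeierstrassCurve ℚ) [W.IsElliptic] [NeZero (W.conductorNorm ℤ)]
    (D : ModularParametrizationData W (W.conductorNorm ℤ)), ¬ W.HasCM →
    2 ^ squareLevelTwistRank (W.conductorNorm ℤ) ∣ congruenceNumber D.f

/-- The number of primes of bad reduction `ω(N)`. -/
def primeCount (N : ℕ) : ℕ := N.primeFactors.card

/-- `p* = ±p ≡ 1 (mod 4)` for an odd prime `p`. -/
def primeStar (p : ℕ) : ℤ := if p % 4 = 1 then (p : ℤ) else -(p : ℤ)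

/-- **ES-33A♯ `DeepTwistDividesCongruenceNumber` (this lens, -es g24 P33.12; elementary, to be PROVED): the RESOLVENT direction is
congruent modulo 4, and gives one more power of 2.**  If `p` is an odd prime with `p² ∣ N`, `ℚ(√p*) = ℚ(√Δ_W)` (`p* · Δ_W` a square:
the quadratic resolvent of `W[2]`), then for every good prime `ℓ` inert in `ℚ(√p*)` Frobenius permutes the three points of order 2
by a TRANSPOSITION, whose matrix in `GL₂(𝔽₂)` has trace `0`, so `a_ℓ` is even and `a_n (1 − χ_{p*}(n)) ≡ 0 (mod 4)` for all `n` —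
provided no prime `q` with `a_q` possibly ODD is inert in `ℚ(√p*)`: the multiplicative primes `q ∥ N` (`a_q = ±1`) and `q = 2`
when `4 ∤ N` (good ordinary or multiplicative reduction at 2; the Eichler–Shimura parity argument does not apply at the residual
prime) — hence the two split hypotheses.  (ENGINE 33 phase T: naive depth ≥ 2 at the good primes `< 400` ⟺ resolvent direction,
872/872 vs 0/18 512; the orbit 1323e1/g1/k1/l1 with `p* = −3 ≡ 5 (mod 8)`, `2 ∤ N`, `v₂(r_E) = 2 = a(E)` shows the hypothesis at 2
is needed.)  The lattice vector of ES-33A then admits one more halving in the direction `p*`, whence `2^{a(E)+1} ∣ r_E`.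
Census (r-currency, ENGINE 33P kit j335842 + partial j335549/j335538, non-CM, N ≤ 1 498): `2^{a(E)+[deep]} ∣ r_E` 4 125/4 125,
290 curves with a deep direction, 6 with equality.  Why it might fail: bookkeeping at the primes dividing `2p`, or CM.
(RIDER, typer -ty g20: PLAIN theorem-target (ES-33A♯).  REF1-AUDIT §256: **SURVIVES, theorem-grade** — re-derived (BC7 (ii): for `ℓ ∤ 2N` inert in `ℚ(√Δ)`, `Frob_ℓ` is a
transposition in `GL₂(𝔽₂) ≅ S₃`, trace 0 ⟹ `a_ℓ` even, and `a_{ℓ^j}` even for odd `j` by the Hecke recursion); census (C2) 90/90, equality 2; **the clause at 2 is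
load-bearing** (mutation «drop it»: 115/119, violators = {1323e1, 1323g1, 1323k1, 1323l1}, `a₀ = 2 = v₂ r` — reproduces -es's in-session refutation exactly); **R256a: the
`jacobiSym (primeStar p) q = 1` clause (odd multiplicative `q`) is PROOF-DRIVEN and CENSUS-UNEXERCISED — 121/121 without it (`N ≤ 2 924`); a prover may try the clause-free
strengthening via a different lattice vector**; R256b (to -es): the 2-adic deep directions `D ∈ {−4 (16 ∣ N), ±8 (64 ∣ N)}` with `D·Δ ∈ ℚ²` also satisfy `2^{a₀+1} ∣ r`
(48/48) — candidate row A♯₂, not typed here.  REF2: beyond print, small theorem-candidate (the mod-4 lift is the content).) -/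
def DeepTwistDividesCongruenceNumber : Prop :=
  ∀ (W : WeierstrassCurve ℚ) [W.IsElliptic] [NeZero (W.conductorNorm ℤ)]
    (D : ModularParametrizationData W (W.conductorNorm ℤ)) (p : ℕ), ¬ W.HasCM → p.Prime → p ≠ 2 →
    p ^ 2 ∣ W.conductorNorm ℤ → IsSquare ((primeStar p : ℚ) * W.Δ) →
    (¬ 4 ∣ W.conductorNorm ℤ → primeStar p % 8 = 1) →
    (∀ q : ℕ, q.Prime → q ≠ 2 → q ∣ W.conductorNorm ℤ → ¬ q ^ 2 ∣ W.conductorNorm ℤ → jacobiSym (primeStar p) q = 1) →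
    2 ^ (squareLevelTwistRank (W.conductorNorm ℤ) + 1) ∣ congruenceNumber D.f

/-- **ES-33B `CongruenceNumberSelmerALFloor` — CANDIDATE (conjecture of this lens, congruence-number currency; HYPOTHESIS mod-2 image
`S₃` (`HasSurjectiveModNGaloisRep 2`), not merely `E(ℚ)[2] = 0`: the non-split-Cartan optimal curve 196a1 (`r_E = 42`, `m_E = 6`,
`dimSel₂ = 1`, `ω = 2`) violates the `t₂ = 0` form — ENGINE 33P kit j335538; the form is
pre-registered as P33.3/P33.9; census on the `S₃` population `N ≤ 1 498` (ENGINE 33P kit j335842, optimal, non-CM): 2 518/2 518, and at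
`4 ∥ N` 299/299 with 154 equalities — CensusES33 §4, §6; implied by the stronger ES-33E below via `twoAdicTwistRank_le_extra`).**
For an optimal `E/ℚ` without rational `2`-torsion: `dim Sel₂(E) + (ω(N) − 1) + a₂(N) ≤ v₂(r_E)` where `a₂(N) = [2⁴ ∣ N] + [2⁶ ∣ N]`
is the `2`-adic twist rank — i.e. the Atkin–Lehner count runs over ALL bad primes (no dip at `v₂(N) = 2`) once degrees are
replaced by congruence numbers, and the `2`-adic twists add on top.  Multiplicatively:
`#Sel₂(E) · 2^{ω(N) + a₂(N)} ≤ 2 · 2^{v₂(r_E)}`.  Why it might fail: a `4 ∥ N` dip curve of ES-32 whose congruence number equals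
its degree (then the Selmer `2` and the `w₄` `2` coincide in `𝕋`), or AL and twist congruences failing to be lattice-independent.
(RIDER, typer -ty g20: `@[conjecture]` (ES-33B).  REF1-AUDIT §256: **SURVIVES** — census (C4) reproduced exactly by the independent re-fold: 2 518/2 518 (748 equalities) on the `S₃`,
`t₂ = 0`, non-CM population `N ≤ 1 498`; at `4 ∥ N` incl. CM 299/299, tight 154; the `S₃` hypothesis is necessary (6 `C₃` curves sit one below the line).  REF2 (21:32Z) with
[cite: Dummigan2006, §1]: the Selmer + Atkin–Lehner floor is WATKINS' conjecture family ([cite: Watkins2002, Conj. 4.1], the strengthening Watkins proposed) read in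
congruence-number currency — conjecture, NEW-COMBINATION (the r-currency exactness is not in print).) -/
@[conjecture] def CongruenceNumberSelmerALFloor : Prop :=
  ∀ (W : WeierstrassCurve ℚ) [W.IsElliptic] [W.IsGloballyMinimal] [NeZero (W.conductorNorm ℤ)]
    (D : ModularParametrizationData W (W.conductorNorm ℤ)),
    (∀ (W'' : WeierstrassCurve ℚ) [W''.IsElliptic] (D'' : ModularParametrizationData W'' (W.conductorNorm ℤ)),
        D''.f = D.f → D.modularDegree ≤ D''.modularDegree) →
    W.HasSurjectiveModNGaloisRep ((2 : ℕ) : ℤ) →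
    Nat.card (W.selmerGroup 2) * 2 ^ (primeCount (W.conductorNorm ℤ) + twoAdicTwistRank (W.conductorNorm ℤ)) ≤
      2 * 2 ^ (padicValNat 2 (congruenceNumber D.f))

/-- `F(v) = [v ≥ 3]·(v − 1)`: the 2-adic extra of the r-currency floor ES-33E. -/
def conductorFloorExtra (v : ℕ) : ℕ := if 3 ≤ v then v - 1 else 0

/-- **ES-33E `CongruenceNumberConductorFloor` (conjecture of this lens, -es g24; the r-currency MASTER LAW behind ES-32 B♯).**
For `W/ℚ` with SURJECTIVE mod-2 representation (`S₃`; then `dimSel₂(W)` and `r_E` are isogeny invariants, so no optimality and no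
minimality hypothesis is needed), conductor `N`, `v = v₂(N)`:  `v₂(r_E) ≥ dimSel₂(W) + ω(N) − 1 + [v ≥ 3]·(v − 1)`.
PRE-REGISTERED (NOTES P33.13) on the `N ≤ 1 498` population (ENGINE 33P kit j335842; optimal, `t₂ = 0`, `S₃`, non-CM): floors
`F(v) = 0,0,0,2,3,4,5` for `v = 0..6`, each ATTAINED (225/374/149/68/59/24/4 equalities; 2 518/2 518); full-range verdict (Sage kit j335426, PARI kit j335594/j335572;
predictions `F(7) = 6`, `F(8) = 7`) in CensusES33 §8.  Combined with the Agashe–Ribet–Stein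
defect conjecture `v₂(r_E/m_E) ≤ ⌊v/2⌋` (their Conj. 2.2, `N ≤ 557`; verified here at `p = 2` on every curve computed) it YIELDS the
m-currency law B♯ of ES-32 with its step `c(v) = ⌈v/2⌉` (`⌈v/2⌉ − 1 = (v − 1) − ⌊v/2⌋`) and the `c(2) = 0` dip (`F(2) − 1`): the curves
tight for B♯ are exactly those with maximal ARS defect.  Anatomy of `F`: the Atkin–Lehner share of the prime 2 is in `ω(N) − 1`;
of the extra `v − 1` (additive, `v ≥ 3`), `a₂(v) = [v ≥ 4] + [v ≥ 6]` is the admissible 2-adic twist lattice (ES-33A, a theorem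
target) and `v − 1 − a₂(v) = 2, 2, 3, 3` (`v = 3..6`) is measured, not derived (MEMO-es §33.5).
Why it might fail: the classes `v = 7, 8` (no `S₃` curve with `r_E` computed yet at `N ≤ 1 498`; B♯ + ARS predict `F = 6, 7`), or an
image-`C₃` analogue (false already at `v = 2`: 196a1, and at `v = 4`).
(RIDER, typer -ty g20: `@[conjecture]` (ES-33E, the r-currency MASTER LAW).  REF1-AUDIT §256: **SURVIVES** — (C3) reproduced EXACTLY: non-CM 2 518/2 518 (incl. CM 2 547/2 547),
min margin 0 at every `v`; equalities by `v = 0..6` = 225/374/149/68/59/24/4 on populations 803/994/290/163/170/50/48 — identical to CensusES33 §4; the `C₃` curves below the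
`S₃` line are exactly {196a1, 324c1, 1444b1, 1764e1 (`v = 2`), 784i1, 1296l1 (`v = 4`)}, margin −1 each; (C7) P33.14 (B♯-tight ⟹ `v₂(r/m) = ⌊v/2⌋`) 0 exceptions.  REF2
(21:32Z): = WATKINS' conjecture family in congruence-number currency + [cite: AgasheRibetStein2012, Conj. 2.2] at 2 + an explicit additive-at-2 term `(v − 1)`; the additive
term and the r-currency exactness are NOT in print ⟹ **conjecture, NEW-COMBINATION**.) -/
@[conjecture] def CongruenceNumberConductorFloor : Prop :=
  ∀ (W : WeierstrassCurve ℚ) [W.IsElliptic] [NeZero (W.conductorNorm ℤ)]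
    (D : ModularParametrizationData W (W.conductorNorm ℤ)), W.HasSurjectiveModNGaloisRep ((2 : ℕ) : ℤ) →
    Nat.card (W.selmerGroup 2) *
        2 ^ (primeCount (W.conductorNorm ℤ) - 1 + conductorFloorExtra (padicValNat 2 (W.conductorNorm ℤ))) ≤
      2 ^ padicValNat 2 (congruenceNumber D.f)

/-- **ES-33C `DipIsCongruenceDefectAtFour` — CANDIDATE (conjecture of this lens; answers REF2 E32-R2′).**  For an optimal `E/ℚ`
with `4 ∥ N` and SURJECTIVE mod-2 representation (the `t₂ = 0`-only form is false: the `C₃`-image dips 196a1, 324c1, 1444b1,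
1764e1 have `r_E/m_E` odd — ENGINE 33P): `v₂(r_E) ≤ v₂(m_E) + 1` (the `p = 2`, `ord₂ N = 2` instance of the Agashe–Ribet–Stein
conjecture `ord_p(r_E/m_E) ≤ ½ ord_p N`), with EQUALITY whenever the ES-32 Selmer–Atkin–Lehner count exceeds the degree:
`dim Sel₂(E) + ω(N) − 1 > v₂(m_E) ⟹ v₂(r_E) = v₂(m_E) + 1` (the «dip» of ES-32B♯ at `v₂(N) = 2` is the ARS defect, not a failure of
the Atkin–Lehner count).  Census (`N ≤ 1 498` + salvaged shards): `v₂(r_E/m_E) ≤ 1` on 441/441 curves with `4 ∥ N`; the 41 `S₃` dips in range all have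
`v₂(r_E) = v₂(m_E) + 1`; the 109 dip levels to `N = 9 772` are kit j335572 (CensusES33 §4, §8).  Why it might fail: an `S₃` dip curve
with `r_E/m_E` odd beyond the computed range. [cite: AgasheRibetStein2012, Conj. 2.2]
(RIDER, typer -ty g20: `@[conjecture]` (ES-33C).  REF1-AUDIT §256: **SURVIVES** — (C5) at `4 ∥ N`, `t₂ = 0`: defect `v₂(r/m)` by (image, ram/unr, dip) = `C₃`-dip {0: 4}, `C₃`-nodip
{0: 6}, `S₃`-ramified {0: 174}, `S₃`-unramified-dip {1: 41}, `S₃`-unramified-nodip {0: 78, 1: 6}; `S₃`: `v₂ r ≤ v₂ m + 1` 299/299, r-floor 299/299 tight 154, dips with defect 1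
41/41 — identical to the memo.  REF2 (21:32Z): beyond print; nearest ARS Prop. 5.1 = [cite: KilfordWiese2008, Thm. 1.7] (`p ∣ r_E`, `p ∤ m_E` ⟹ multiplicity one fails for
`𝔪 = Ann E[p]`); conjecture-grade.) -/
@[conjecture] def DipIsCongruenceDefectAtFour : Prop :=
  ∀ (W : WeierstrassCurve ℚ) [W.IsElliptic] [W.IsGloballyMinimal] [NeZero (W.conductorNorm ℤ)]
    (D : ModularParametrizationData W (W.conductorNorm ℤ)),
    (∀ (W'' : WeierstrassCurve ℚ) [W''.IsElliptic] (D'' : ModularParametrizationData W'' (W.conductorNorm ℤ)),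
        D''.f = D.f → D.modularDegree ≤ D''.modularDegree) →
    W.HasSurjectiveModNGaloisRep ((2 : ℕ) : ℤ) → padicValNat 2 (W.conductorNorm ℤ) = 2 →
    padicValNat 2 (congruenceNumber D.f) ≤ padicValNat 2 D.modularDegree + 1 ∧
      (2 * 2 ^ padicValNat 2 D.modularDegree < Nat.card (W.selmerGroup 2) * 2 ^ primeCount (W.conductorNorm ℤ) →
        padicValNat 2 (congruenceNumber D.f) = padicValNat 2 D.modularDegree + 1)

/-- **ES-33B on the slice of the crux, in the form the route consumes: `TwistALMinimalCongruenceSelmerTrivialOnSlice`.**  For the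
crux's `W` (non-CM, surjective `2`-adic image, odd torsion, odd Tamagawa product, analytic rank `1`) and its optimal datum: if the
CONGRUENCE NUMBER sits on the Atkin–Lehner-plus-twist floor, `v₂(r_E) = ω(N) − 1 + a₂(N) + 1` (the `+1` = the rational point's own
Selmer class), then `Sel₂(W) ≅ ℤ/2`, so `Ш(W)[2^∞] = 0` — the algebraic half of `BSD₂(W)` on that sub-slice.  A consequence of
`CongruenceNumberSelmerALFloor`; conjecture.
(RIDER, typer -ty g20: `@[conjecture]` — ES-33B on the slice of crux `RankOneAtTwoBigImageOddLocal` (stmt-23715), in the form the route consumes; a consequence of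
`CongruenceNumberSelmerALFloor` by exponent arithmetic (kernel `sliceTrivial_of_floor`, REF1: kernel-checked).  REF1 §256 PARTITION: none — the r-currency rows feed the 23715
slice only through this glue; BSD is not proved by it.) -/
@[conjecture] def TwistALMinimalCongruenceSelmerTrivialOnSlice : Prop :=
  ∀ (W : WeierstrassCurve ℚ) [W.IsElliptic] [W.IsGloballyMinimal] [NeZero (W.conductorNorm ℤ)],
    ¬ W.HasCM → (∀ n : ℕ, W.HasSurjectiveModNGaloisRep ((2 ^ n : ℕ) : ℤ)) → Odd W.torsionOrder → Odd W.tamagawaProduct →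
    W.analyticRank = 1 →
    ∀ (D : ModularParametrizationData W (W.conductorNorm ℤ)),
    (∀ (W'' : WeierstrassCurve ℚ) [W''.IsElliptic] (D'' : ModularParametrizationData W'' (W.conductorNorm ℤ)),
        D''.f = D.f → D.modularDegree ≤ D''.modularDegree) →
    padicValNat 2 (congruenceNumber D.f) = primeCount (W.conductorNorm ℤ) + twoAdicTwistRank (W.conductorNorm ℤ) →
    Nat.card (W.selmerGroup 2) ≤ 2

/-! ### ES-33A⁰ — the abstract SIGNED-TWIST LATTICE LEMMA (pure algebra over the tree's congruence-number API; the
first OPEN lemma of the ES-33A line, provable now: `Finset.prod_add` + `dvd_congruenceNumber_of_sub_eq_smul`) -/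

/-! ### ES-33D — the dip needs `E[2]` unramified at 2 (ENGINE 33L, kit j335675) -/

/-- **`E[2]` is unramified at 2**, typed elementarily (no local fields): some number field in which
`2` is unramified (`2 ∤ disc K`) contains all four `2`-torsion points.  Equivalent to
`ℚ(E[2])/ℚ` unramified above `2` (if `K ⊇ ℚ(E[2])` has odd discriminant then so is every subfield
unramified at 2; conversely take `K = ℚ(E[2])`).  For curves without rational `2`-torsion it is
decided by the parity of the discriminant of the cubic field of a `2`-torsion abscissa
(Stickelberger), which is what ENGINE 33L computes (`nfinit` + `idealprimedec`). [folklore] -/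
def TwoTorsionUnramifiedAtTwo (W : WeierstrassCurve ℚ) : Prop :=
  ∃ (K : Type) (_ : Field K) (_ : NumberField K),
    ¬ (2 : ℤ) ∣ NumberField.discr K ∧ Nat.card (W.torsionPoints K 2) = 4

/-- **ES-33D `NoDipWhenRamifiedAtTwo` — CANDIDATE (conjecture of this lens; modular-degree currency).**
For an `X₀(N)`-optimal `E` with `4 ∥ N`, no rational `2`-torsion and `E[2]` RAMIFIED at `2`:
`dim_𝔽₂ Sel₂(E) + ω(N) − 1 ≤ v₂(m_E)` — i.e. the `4 ∥ N` dip `g(2) = −1` of ES-32 law B♯ does not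
occur.  Census (ENGINE 32S × ENGINE 33L, all optimal `N ≤ 10⁴`): **1 421 / 1 421, tight 311**; all
150 dip curves have `E[2]` unramified at `2` (unramified sub-population: 952 curves, 150 dips).
Dictionary: `ρ̄_{E,2}` unramified at `2` with `4 ∣ N` is the level-lowerable case — `2`-old
congruences of `f_E` exist and the Agashe–Ribet–Stein defect `r_E/m_E` can absorb one `2`
(ES-33C); ramified `ρ̄` has no `2`-old companion.  Falsifier: one optimal `E`, `4 ∥ N`, `E(ℚ)[2] = 0`,
`E[2]` ramified at `2`, with `v₂(m_E) < dimSel₂ + ω(N) − 1`.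
(RIDER, typer -ty g20: `@[conjecture]` (ES-33D, modular-degree currency).  REF1-AUDIT §256: **SURVIVES** — (C6) on all 38 042 curves: `4 ∥ N`, `t₂ = 0`, OWN-ramified ⟹ no dip
1 421/1 421, tight 311; unramified 952 = `S₃` 906 (146 dips) + `C₃` 46 (4 dips); REF1's «`E[2]` ramified at 2» recomputation agrees with ENGINE 33L `ram2` on 38 042/38 042 and
its dip list = the memo's 150 labels exactly; the ramified hypothesis is necessary (150 unramified dips).  REF2 (21:32Z): the «unramified at 2» criterion at `4 ∥ N` is the
level-`4M` analogue of Kilford–Wiese's `p ∤ N` multiplicity-one failure ([cite: KilfordWiese2008, Thm. 1.2]) with no printed counterpart found ⟹ conjecture-grade beyond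
print.) -/
@[conjecture] def NoDipWhenRamifiedAtTwo : Prop :=
  ∀ (W : WeierstrassCurve ℚ) [W.IsElliptic] [W.IsGloballyMinimal] [NeZero (W.conductorNorm ℤ)]
    (D : ModularParametrizationData W (W.conductorNorm ℤ)),
    (∀ (W'' : WeierstrassCurve ℚ) [W''.IsElliptic] (D'' : ModularParametrizationData W'' (W.conductorNorm ℤ)),
        D''.f = D.f → D.modularDegree ≤ D''.modularDegree) →
    Nat.card (W.toAffine.Point[(2 : ℤ)]) = 1 → padicValNat 2 (W.conductorNorm ℤ) = 2 →
    ¬ TwoTorsionUnramifiedAtTwo W →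
    Nat.card (W.selmerGroup 2) * 2 ^ (primeCount (W.conductorNorm ℤ) - 1) ≤ 2 ^ padicValNat 2 D.modularDegree

/-- **ES-33A⁰ `SignedTwistLatticeLemma` (theorem target, elementary).**  Let `0 ≠ f ∈ S₂(Γ₀(N); ℤ)` and let
`g_S ∈ S₂(Γ₀(N))`, `S ⊆ {0,…,k-1}`, be forms with `g_∅ = f`, `g_S ⊥ f` integral for `S ≠ ∅`, and coefficientwise
`aₙ(g_S) = (∏_{i ∈ S} εᵢ(n))·aₙ(f)` with signs `εᵢ(n) ∈ {±1}` — or `aₙ(f) = aₙ(g_S) = 0`.  Then `2^k ∣ r_f`.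
Proof: `h := 2^{-k} Σ_S (-1)^{|S|} g_S` has `aₙ(h) = 2^{-k} aₙ(f) ∏ᵢ (1 - εᵢ(n)) ∈ ℤ` (each factor is `0` or `2`),
`f - (f - 2^k h) = 2^k • h` and `f - 2^k h = -Σ_{S ≠ ∅} (-1)^{|S|} g_S ∈ (ℤf)^⊥`; apply
`dvd_congruenceNumber_of_sub_eq_smul`.  In ES-33A the `g_S` are the twists `f ⊗ χ_S` (`εᵢ = χᵢ`).
(RIDER, typer -ty g20: PLAIN theorem-target (ES-33A⁰), «PROVABLE NOW» — a SUPPORT ITEM for a prover, not a conjecture.  REF1-AUDIT §256: **SURVIVES, theorem-grade; elementary;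
provable in-tree from `dvd_congruenceNumber_of_sub_eq_smul`** (A2: with `g := −Σ_{S ≠ ∅} (−1)^{|S|} g_S ∈ integralOrthogonal0 f` and `h := 2^{−k} Σ_S (−1)^{|S|} g_S`, integral
coefficientwise because `Σ_S (−1)^{|S|} ∏_{i ∈ S} ε_i(n) = ∏_i (1 − ε_i(n)) ∈ {0, 2^k}` when all `ε_i(n) = ±1`, and `= 0` on the zero branch).) -/
def SignedTwistLatticeLemma : Prop :=
  ∀ (N : ℕ) [NeZero N] (k : ℕ) (f : CuspForm (CongruenceSubgroup.Gamma0 N) 2) (ε : Fin k → ℕ → ℤ)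
    (g : Finset (Fin k) → CuspForm (CongruenceSubgroup.Gamma0 N) 2),
    f ≠ 0 → f ∈ integralCuspForms0 N 2 → g ∅ = f →
    (∀ S : Finset (Fin k), S.Nonempty → g S ∈ integralOrthogonal0 f) →
    (∀ (S : Finset (Fin k)) (n : ℕ),
        ((∀ i, ε i n = 1 ∨ ε i n = -1) ∧ cuspCoeff (g S) n = (∏ i ∈ S, (ε i n : ℂ)) * cuspCoeff f n) ∨
        (cuspCoeff f n = 0 ∧ cuspCoeff (g S) n = 0)) →
    2 ^ k ∣ congruenceNumber f

/-- **ES-33A¹ `AdmissibleTwistsExist` (PRINT, statement-only; Shimura 1971 Prop. 3.64 + Hecke self-adjointness +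
«non-CM ⟹ no self-twist»): for the newform `f` of a non-CM `W` of conductor `N` and pairwise distinct quadratic
characters `χ₁ … χ_k` given as sign functions `εᵢ : ℕ → ℤ` with `cond(χᵢ)² ∣ N`, the twists `f ⊗ χ_S` exist in
`S₂(Γ₀(N); ℤ)`, are orthogonal to `f` for `S ≠ ∅`, and have coefficients `χ_S(n) aₙ` (`= 0` when `aₙ = 0`, which
covers every `n` sharing a prime with a conductor since `W` is additive there).  Typed as the hypothesis shape the
abstract lemma consumes, for the square-level characters counted by `squareLevelTwistRank`. (Shimura 1971,
Prop. 3.64 [cite: Shimura1971, Prop. 3.64]; [cite: Yazdani2011OddModularDegree, proof of Prop. 2.10].)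
(RIDER, typer -ty g20: PLAIN, PRINT-grade statement-only (ES-33A¹).  REF1-AUDIT §256: print-grade (Shimura 3.64 + strong multiplicity one; BC7 (i)).  Citation tag normalised by
the typer (the workfile's single tag named two sources).  Kernel `twistLattice_of`: ES-33A⁰ ∧ ES-33A¹ ⟹ ES-33A.) -/
def AdmissibleTwistsExist : Prop :=
  ∀ (W : WeierstrassCurve ℚ) [W.IsElliptic] [NeZero (W.conductorNorm ℤ)]
    (D : ModularParametrizationData W (W.conductorNorm ℤ)), ¬ W.HasCM →
    ∃ (ε : Fin (squareLevelTwistRank (W.conductorNorm ℤ)) → ℕ → ℤ)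
      (g : Finset (Fin (squareLevelTwistRank (W.conductorNorm ℤ))) → CuspForm (CongruenceSubgroup.Gamma0 (W.conductorNorm ℤ)) 2),
      g ∅ = D.f ∧ (∀ S, S.Nonempty → g S ∈ integralOrthogonal0 D.f) ∧
      (∀ S n, ((∀ i, ε i n = 1 ∨ ε i n = -1) ∧ cuspCoeff (g S) n = (∏ i ∈ S, (ε i n : ℂ)) * cuspCoeff D.f n) ∨
        (cuspCoeff D.f n = 0 ∧ cuspCoeff (g S) n = 0))

/-- ES-33F `CongruenceNumberTwistInvariant` (target / support statement; CONJECTURE, theorem-grade candidate; -es g24 addendum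
2026-08-30): the congruence number of the newform of an elliptic curve is invariant under CONDUCTOR-PRESERVING quadratic twists:
if `cond(W ⊗ χ_d) = cond(W)` then `r_{W ⊗ χ_d} = r_W`.  Evidence: r equal EXACTLY on 1 389 / 1 389 pairs of optimal curves of equal
conductor N ≤ 3 532 related by a level-preserving quadratic twist (626 twists by −4, 8, −8; 763 by p* with v_p(N) = 2; ENGINE 33P,
kit j335842/j335594/j335572, Sage j335426), while `v₂` of the modular degree differs by 1 in 68 of the 626 2-adic pairs (Kodaira II ↔ I₂*
at N = 2⁷·m) — the mechanism of the 26 counterexamples to Agashe–Ribet–Stein Conj. 2.2 at p = 2 (CensusES33 §10–§11).  Conceptual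
anchor: the congruence module measures `L(1, Ad f)` [Hida 2000, (CN2)] and `Ad(f ⊗ χ) ≅ Ad f`; exactness at 2 is the new content.
Why it might fail: a level-preserving twist need not induce an automorphism of `S₂(Γ₀(N), ℤ)` (old forms from levels with smaller
2-part lose coefficients under `⊗ χ`), so the invariance of the FULL congruence module is not formal.
(RIDER, typer -ty g21: PLAIN `def` per REF1 R288c — «keep it OUT of `@[conjecture]`»; -es's own label «CONJECTURE, theorem-grade candidate» is superseded by the audit: R288a
re-tags ES-33F as a SUPPORT THEOREM-CANDIDATE with proof sketch.  PORT: -es g24 crux workfile v2 `Cruxes/RankOneAtTwoBigImageOddLocal/TwistLatticeES33.lean` c5c258e7def98a9e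
l.284–313, body VERBATIM; -es asks the coordinator to file it as a SUPPORT item of route ByReductionTypeAtTwo (D-es-97) — a ledger matter, not this file's.  REF1-AUDIT §288
(-ref1 g23, 2026-08-30T01:31:21Z; Probe288.lean f15350cbf0285eb5 rc 0 · 0 warnings, negative control Probe288_ctrl fails at the planted line; v1 → v2 = + 1 import + this
appended block, 0 v1 bytes changed ⟹ §256 stands): **SURVIVES and UPGRADED TO THEOREM-GRADE (elementary)** — K288.1 `es33F_shape` Iff.rfl (binders = the informal statement),
`dvd_iff_of_twist` both directions; K288.2 `D`, `D′` at level = conductor ⟹ `f`, `f′` are THE newforms; the typed `Nat.card` = order of the cyclic congruence module `C_f/ℤ` =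
the Agashe–Ribet–Stein exponent `r_E` ⟹ currencies agree; `d` square / CM self-twist trivially true, `d = 0` excluded, no junk, A3 witness 1152a1; the `∀ d` law ⟺ the
prime-discriminant cases = the census shape (1 389/1 389); **K288.3 REF1 PROOF SKETCH**: with `χ = χ_d`, `m = cond χ`, `m² ∣ N`: `R_χ` maps `S₂(Γ₀(N), ℤ)` to itself (level
`lcm(N, m²) = N`), `R_χ f = f′` EXACTLY (`a_p = 0` at `p² ∣ N`), and `T_n R = χ(n) R T_n` sends every packet `g ≠ f` into `f′^⊥`, so `c_{f′}(R s) = c_f(s)` ⟹ `(1/r_f)ℤ ⊂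
(1/r_{f′})ℤ` ⟹ `r_f ∣ r_{f′}`, and symmetrically ⟹ `r_f = r_{f′}` ∎ (standard print only: twisting-operator level, Atkin–Lehner `a_p = 0`, multiplicity one; no Hida (CN2);
presearch corpus + galaxy: no printed statement — folklore-grade); K288.4 the only added hypothesis `m² ∣ N` is AUTOMATIC for conductor-preserving twists (odd `p`: `v_p(N) ≥ 2`;
at 2: depth ⟹ `2a(χ₂) ≤ a(π₂)`); DATA on -es's twist33 rows (38 042 curves): χ₋₄-preserving only at `v₂(N) ∈ {5,6,7,8}` (1278/1873/508/212), χ_{±8} only at `v ∈ {7,8}`, odd `p*`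
only at `v_p ∈ {2,3,4,5}` — 0/15 697 violations (twv288.py 3a00f9cb167fc529); K288.5: Agashe–Ribet–Stein Conj. 2.2 is printed with «verified … N ≤ 557» and -es's 26 failures are
at `N ≥ 1152` ⟹ no conflict with print; K288.3 makes them STRUCTURAL (`r` constant on the twist orbit, `m` jumps II ↔ I₂* / III ↔ III*); REF1's bar for citing «ARS 2.2 false at
2» as fact: a third engine (Sage j336920) or a formal K288.3 + one certified `m`-pair.  Riders R288a (this re-tag; optional explicit hypothesis `m² ∣ N` NOT added — the port is
verbatim), R288b (REF2 placement input: folklore-grade elementary law; the ARS-2.2-at-2 failure is computational + structurally explained, outside ARS's verified range — cite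
with the third-engine caveat), R288c (this port), R288d (the proof predicts invariance also for composite `d` and is attached to `f`, not to the optimal curve — optimality is
immaterial for `r`, matters for `m`), R288e (ES-33E and ES-33F are the workfile's two untagged Props = theorem-candidates, consistent).  REF2 placement: owed at port time
(R288b input).  Kernel sibling v2: `dvd_congruenceNumber_of_twist` VERBATIM.) -/
def CongruenceNumberTwistInvariant : Prop :=
  ∀ (W : WeierstrassCurve ℚ) [W.IsElliptic] (d : ℚ) [(W.quadraticTwist d).IsElliptic]
    [NeZero (W.conductorNorm ℤ)] [NeZero ((W.quadraticTwist d).conductorNorm ℤ)]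
    (D : ModularParametrizationData W (W.conductorNorm ℤ))
    (D' : ModularParametrizationData (W.quadraticTwist d) ((W.quadraticTwist d).conductorNorm ℤ)),
    (W.quadraticTwist d).conductorNorm ℤ = W.conductorNorm ℤ → congruenceNumber D'.f = congruenceNumber D.f

/-! ## Addendum 3 (-es g24, 2026-08-30; answers REF1 R256b): ES-33A♯ in GENERAL RESOLVENT FORM.
The deep direction of ES-33A♯ is the quadratic RESOLVENT `K = ℚ(√Δ_W)` of `W[2]`, whatever its discriminant: an odd prime
discriminant `p*` (the typed ES-33A♯), a 2-adic one `−4, 8, −8` (REF1's candidate row A♯₂, R256b), or a COMPOSITE one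
(`ℚ(√−15)` at `N = 225`, `ℚ(√−6)` at `64·9 ∣ N`, …).  One statement covers all three: if the character `χ_K` lies in the
admissible group `G_N` (every odd prime of `disc K` to the square in `N`, `16 ∣ N` if `χ₋₄` is involved, `64 ∣ N` if `χ_{±8}` is),
every multiplicative prime `q ∥ N` splits in `K`, and `2` splits in `K` unless `4 ∣ N`, then `2^{a₀(N)+1} ∣ r_W`.  PROOF (as §33.2♯,
one remark added): extend `χ_K` to an `𝔽₂`-basis `χ_K = χ₁, χ₂, …, χ_k` of `G_N` (`k = a₀(N)`); the vector
`h' = 2^{-(k+1)} Σ_S (−1)^{|S|} f ⊗ χ_S` has `n`-th coefficient `0` unless `n` is prime to every conductor (else `a_n = 0`, those primes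
being additive) and `χᵢ(n) = −1` for all `i`, in which case it is `a_n / 2` with `χ_K(n) = −1`; then some prime `q ∣ n` to an odd power
is inert in `K`: `q` good ⟹ `Frob_q` is a transposition on `W[2]`, trace `0`, `a_q` even, `a_{q^{odd}}` even; `q` additive ⟹ `a_q = 0`;
`q` multiplicative is excluded by the split clause (and `q = 2 ∤ N` by the clause at 2) — so `h'` is integral and `2^{k+1} ∣ r_f` by
`dvd_congruenceNumber_of_sub_eq_smul`.  (The basis MUST contain `χ_K`: with `K = ℚ(√−15)`, `N = 225` and the basis `χ₋₃, χ₅` the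
vector is not integral.)  CENSUS (`an33/resolvent33.py` on the 6 466 non-CM curves with `r_E` known, `N ≤ 3 532`, ENGINE 33/33P two
engines agreeing 2 481/2 481): resolvent admissible and all clauses met — type `p*` 192/192 (2 equalities: 100a1 `r = 12`, 676a1),
type 2-adic 117/117 (5 equalities: 80b1 `r = 4`, 208c1, 464e1, 848d1, 2768c1), type composite 65/65 (`m ∈ {−15: 23, −6: 28, 6: 6,
33: 3, 21: 2, 10: 2, −39: 1}`, 0 equalities); MUTATIONS: dropping the split clause — still 245/245, 145/145, 69/69 (the clause is
proof-driven, census-unexercised, as REF1 R256a found for `p*`); dropping the clause at 2 — 4 violators, the orbit 1323e1/g1/k1/l1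
(`m = −3`, `2 ∤ N`), none of 2-adic/composite type (there `4 ∣ N` automatically or not: composite 78/78).  Not found in print (queries
of §33.2♯).  BSD is not advanced by this; it is a statement about the congruence module at 2. -/

/-- **ES-33A♯ (general resolvent form) `ResolventTwistDividesCongruenceNumber`** (this lens; elementary, theorem-grade target):
for non-CM `W` of conductor `N` and a squarefree integer `m ≠ 1` with `m · Δ_W` a rational square (so `K = ℚ(√m)` is the quadratic
resolvent of `W[2]`): if every odd prime `p ∣ m` has `p² ∣ N`, `16 ∣ N` when `m ≡ 3 (mod 4)`, `64 ∣ N` when `m` is even (i.e.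
`χ_K ∈ G_N`), every odd `q ∥ N` has `(m/q) = +1`, and `m ≡ 1 (mod 8)` unless `4 ∣ N`, then `2^{a₀(N)+1} ∣ congruenceNumber f_W`.
Specialises to ES-33A♯ (`m = p*`, `deepTwist_of_resolvent`) and to A♯₂ (`m ∈ {−1, 2, −2}`, `twoAdicDeep_of_resolvent`).
Why it might fail: only the orthogonality / level bookkeeping of `f ⊗ χ_S` at the primes of `cond χ` (Shimura 3.64), or CM.
(RIDER, typer -ty g21: PLAIN `def` (theorem-grade TARGET, nothing asserted).  REF1-AUDIT §301 (-ref1 g23; Probe301 = workfile v4 8667786b017bfee1 AS-IS + block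
`REF1_301`, 20 items, farm rc 0 · 0 warn · 0 sorry; control rc 1): **(R) SURVIVES, THEOREM-GRADE (elementary)** — the three divisibility clauses are `cond(χ_K)² ∣ N` exactly;
Lean's ℤ-`%` is `emod`, so negative `m` is read correctly (`(−1) % 4 = 3` → the 16-clause, `(−3) % 4 = 1`, `(−7) % 8 = 1`, `(−3) % 8 = 5` — kernel `decide`); the split clause
for odd `q` only is safe since `q ∣ m` forces `q² ∣ N`; the clause at 2 covers `2 ∤ N` and `2 ∥ N`; the `h′`-integrality argument checked incl. the `χᵢ(n) = 0 ⟹ additive ⟹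
a_n = 0` case.  INDEPENDENT RE-TALLY (REF1's own code on -es's published rows, `REF1-data/b301/tally301.py`): 374 instances / 0 violations / 7 equalities, types
`p*` 192 / 2-adic 117 / composite 65; drop-at-2 violators exactly 1323e1/g1/k1/l1; drop-split +85 instances, 0 violations (the odd split clause is proof-driven and still
census-UNEXERCISED, R256a); r-engines agree 2 481/2 481.  Not found in print (-es §33.2♯ queries).  REF2 placement: owed.
[cite: Shimura1971, Prop. 3.64]) -/
def ResolventTwistDividesCongruenceNumber : Prop :=
  ∀ (W : WeierstrassCurve ℚ) [W.IsElliptic] [NeZero (W.conductorNorm ℤ)]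
    (D : ModularParametrizationData W (W.conductorNorm ℤ)) (m : ℤ), ¬ W.HasCM → Squarefree m → m ≠ 1 →
    IsSquare ((m : ℚ) * W.Δ) →
    (∀ p : ℕ, p.Prime → p ≠ 2 → (p : ℤ) ∣ m → p ^ 2 ∣ W.conductorNorm ℤ) →
    (m % 4 = 3 → 2 ^ 4 ∣ W.conductorNorm ℤ) → (2 ∣ m → 2 ^ 6 ∣ W.conductorNorm ℤ) →
    (∀ q : ℕ, q.Prime → q ≠ 2 → q ∣ W.conductorNorm ℤ → ¬ q ^ 2 ∣ W.conductorNorm ℤ → jacobiSym m q = 1) →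
    (¬ 4 ∣ W.conductorNorm ℤ → m % 8 = 1) →
    2 ^ (squareLevelTwistRank (W.conductorNorm ℤ) + 1) ∣ congruenceNumber D.f

/-- **ES-33A♯₂ `TwoAdicDeepTwistDividesCongruenceNumber`** (REF1 R256b's candidate row, typed): the 2-adic resolvents.  Non-CM `W`,
`m ∈ {−1, 2, −2}` with `m · Δ_W` a square (`K = ℚ(i), ℚ(√2), ℚ(√−2)`), `16 ∣ N` for `m = −1`, `64 ∣ N` for `m = ±2`, and every odd
`q ∥ N` split in `K` ⟹ `2^{a₀(N)+1} ∣ congruenceNumber f_W`.  (No clause at 2: `16 ∣ N`.)  Census: 117/117 with the split clause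
(5 equalities), 145/145 without it; REF1 §256 (C2): 48/48 at `N ≤ 2 924`.
(RIDER, typer: PLAIN `def`.  REF1 §301: **(A♯₂) SURVIVES** (= REF1 R256b's candidate row, typed; kernel glue `twoAdicDeep_of_resolvent` (R) ⟹ (A♯₂) and
`deepTwist_of_resolvent` (R) ⟹ ES-33A♯ `DeepTwistDividesCongruenceNumber`, both PROVED, in the kernel sibling); census 117/117 with 5 equalities (80b1 `r = 4`, 208c1, 464e1,
848d1, 2768c1), REF1's 48/48 reproduced and extended.  REF2 placement: owed.) -/
def TwoAdicDeepTwistDividesCongruenceNumber : Prop :=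
  ∀ (W : WeierstrassCurve ℚ) [W.IsElliptic] [NeZero (W.conductorNorm ℤ)]
    (D : ModularParametrizationData W (W.conductorNorm ℤ)) (m : ℤ), ¬ W.HasCM → (m = -1 ∨ m = 2 ∨ m = -2) →
    IsSquare ((m : ℚ) * W.Δ) → (m = -1 → 2 ^ 4 ∣ W.conductorNorm ℤ) → (m = 2 ∨ m = -2 → 2 ^ 6 ∣ W.conductorNorm ℤ) →
    (∀ q : ℕ, q.Prime → q ≠ 2 → q ∣ W.conductorNorm ℤ → ¬ q ^ 2 ∣ W.conductorNorm ℤ → jacobiSym m q = 1) →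
    2 ^ (squareLevelTwistRank (W.conductorNorm ℤ) + 1) ∣ congruenceNumber D.f

/-! ## Addendum 4 (session 3): the odd-`ℓ` twin — the TWIST-STABILISER of `ρ̄_{W,ℓ}` inside `G_N` divides `r_W`

The signed object behind ES-33A/A♯, prime by prime: the subgroup of `G_N` (quadratic `χ` with `cond(χ)² ∣ N`) that stabilises the
Galois representation modulo `ℓ` — `f ⊗ χ ≡ f (mod ℓ)` coefficientwise iff `ℓ ∣ a_n` whenever `χ(n) = −1`.  At `ℓ = 2` EVERY `χ ∈ G_N`
stabilises (`χ ≡ 1 mod 2`), whence `2^{a₀(N)}` (ES-33A), and the resolvent character stabilises modulo `4`, whence `+1` (ES-33A♯).  At an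
odd `ℓ` with `ℓ² ∣ N` the character `χ_{ℓ*}` lies in `G_N`; it stabilises `ρ̄_{W,ℓ}` tracewise iff `ℓ ∣ a_p` for every good `p` with
`(ℓ*/p) = −1`, and for `ℓ = 3` this is AUTOMATIC when `ρ̄_{W,3}` is reducible: `a_p ≡ ψ(p) + ψ(p)⁻¹p ≡ ψ(p)(1 + p) ≡ 0 (mod 3)` for
`p ≡ 2 (mod 3)` (`ψ` quadratic).  Same lattice proof as ES-33A♯ with `2` replaced by `ℓ`: `h = (f − f ⊗ χ_{ℓ*})/ℓ` is integral once every
multiplicative `q ∥ N` splits in `ℚ(√ℓ*)` (`a_q = ±1` obstructs otherwise; `q = 2 ∥ N` needs `ℓ* ≡ ±1 mod 8`), `f − ℓh = f ⊗ χ_{ℓ*} ⊥ f`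
(non-CM; for CM by `ℚ(√ℓ*)` itself `f ⊗ χ = f` and the statement is void — all 16 census «violators» have `j ∈ {0, −3375, −32768}` at
`ℓ = 3, 7, 11`), so `ℓ ∣ r_f` by `dvd_congruenceNumber_of_sub_eq_smul`.
CENSUS (`an33/odd33.py`, the 6 549 curves with `r_E` known, `N ≤ 3 532` + dips): ℓ = 3, non-CM, `9 ∣ N`, rational 3-isogeny, split
clause — `3 ∣ r_E` 64/64 (base rate without the hypotheses 938/1 132 = 83 %); `3 ∣ m_E` 62/64 and `3 ∣ r_E/m_E` 38/64 — unlike the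
2-adic deep twist (which lives in `r/m`), the 3-adic twist congruence is usually visible in the modular degree itself; tracewise `H₃`
beyond 3-isogeny: 3 curves, all CM-dihedral, 3/3.  ℓ = 5, 7, 11, 13: every curve meeting `H_ℓ ∧ split_ℓ` in range is CM; the ones whose
CM field is not `ℚ(√ℓ*)` (225a1/b1 at `ℓ = 5`) hold 2/2.  MUTATION (split clause dropped; ℓ = 3, non-CM, 3-isogeny): 231/248 — 17
violators: here the split clause is LOAD-BEARING in the data (at `ℓ = 2` it was census-unexercised).  Nearest print: Watkins, Exp. Math.
11 (2002) §4, p. 500 records empirically that square divisors of the level and 3-isogenies influence `3 ∣ m_E` and that «there still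
seems to be another factor», with no mechanism [corpus: paper:doi-10-1080-10586458-2002-10504701 p.14]; the twist-congruence mechanism,
its split clause and the `ℓ`-uniform statement are this lens's (queries: NOTES `## presearch g24` cont.).  Not a BSD statement. -/

/-- **ES-33Gℓ `OddTwistStabiliserDividesCongruenceNumber`** (this lens; elementary, theorem-grade target): for non-CM, globally minimal
`W` of conductor `N`, an odd prime `ℓ` with `ℓ² ∣ N` such that `ℓ ∣ a_p(W)` for every prime `p ∤ N`, `p` odd, with `(ℓ*/p) = −1`
(and `ℓ ∣ a_2(W)` if `2 ∤ N` and `ℓ* ≢ ±1 mod 8`), every odd multiplicative `q ∥ N` having `(ℓ*/q) = +1`, and `ℓ* ≡ ±1 (mod 8)` if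
`2 ∥ N`: then `ℓ ∣ congruenceNumber f_W`.  (`ℓ* = primeStar ℓ`; `(ℓ*/p) = (p/ℓ)`.)  Why it might fail: only the level / orthogonality
bookkeeping of `f ⊗ χ_{ℓ*}` (Shimura 3.64; Atkin–Li), exactly as for ES-33A♯.
(RIDER, typer: PLAIN `def` (theorem-grade TARGET).  REF1 §301: **(Gℓ) SURVIVES, THEOREM-GRADE** — `h = (f − f⊗χ_{ℓ*})/ℓ` is integral via the hypothesis
`H_ℓ` + the Hecke recursion `a_{q^{j+1}} ≡ −q·a_{q^{j−1}} (mod ℓ)`, `ℓ` additive, split clauses; `[IsGloballyMinimal]` rightly present for `frobeniusTrace`.  R301a (cosmetic):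
`primeStar ℓ ≡ 1 (mod 4)` for odd `ℓ`, so the disjunct `% 8 = 7` is dead (never satisfied) — harmless.  REF2 placement: owed.
[cite: Shimura1971, Prop. 3.64]
[cite: AtkinLi1978]) -/
def OddTwistStabiliserDividesCongruenceNumber : Prop :=
  ∀ (W : WeierstrassCurve ℚ) [W.IsElliptic] [W.IsGloballyMinimal] [NeZero (W.conductorNorm ℤ)]
    (D : ModularParametrizationData W (W.conductorNorm ℤ)) (ℓ : ℕ), ℓ.Prime → ℓ ≠ 2 → ¬ W.HasCM →
    ℓ ^ 2 ∣ W.conductorNorm ℤ →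
    (∀ p : ℕ, p.Prime → p ≠ 2 → ¬ p ∣ W.conductorNorm ℤ → jacobiSym (primeStar ℓ) p = -1 → (ℓ : ℤ) ∣ W.frobeniusTrace p) →
    (¬ 2 ∣ W.conductorNorm ℤ → ¬ (primeStar ℓ % 8 = 1 ∨ primeStar ℓ % 8 = 7) → (ℓ : ℤ) ∣ W.frobeniusTrace 2) →
    (∀ q : ℕ, q.Prime → q ≠ 2 → q ∣ W.conductorNorm ℤ → ¬ q ^ 2 ∣ W.conductorNorm ℤ → jacobiSym (primeStar ℓ) q = 1) →
    (2 ∣ W.conductorNorm ℤ → ¬ 4 ∣ W.conductorNorm ℤ → (primeStar ℓ % 8 = 1 ∨ primeStar ℓ % 8 = 7)) →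
    (ℓ : ℤ) ∣ congruenceNumber D.f

/-- The trace fact that makes `ℓ = 3` automatic (IN PRINT, folklore; e.g. the isogeny-character computation in Serre 1972 §5 /
Silverman AEC Ex. 8.?): if `ρ̄_{W,3}` is reducible (a rational 3-isogeny), then `3 ∣ a_p(W)` for every good `p ≡ 2 (mod 3)` —
`a_p ≡ ψ(p) + ψ(p)⁻¹ p` with `ψ² = 1`.  Filed as the shape of the Literature fact the corollary needs; not proved here.
(RIDER, typer -ty g21: PLAIN `def`, ported VERBATIM as -es's «shape of the Literature fact» — REF1 §301: **(T) TRUE IN PRINT** (`ρ̄₃` reducible ⟹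
`a_p ≡ ψ(p)(1+p) ≡ 0 (mod 3)` for good `p ≡ 2 (mod 3)`, `p = 2` included, `p = 3` excluded by `p % 3 = 2` ✓; 0 failures on 1 500 3-isogeny curves × good `p ≡ 2 (3)`,
`p < 200`); R301b: cite Silverman AEC (trace of Frobenius V.2.3.1 with Rem. V.2.6, determinant of `ρ̄_ℓ` = cyclotomic character III.8.6) instead of the docstring's
«Ex. 8.?»; a literature-prover may vendor it under `Literature/NumberTheory/EllipticCurves/` and discharge it (the isogeny character `ψ` with `ψ² = 1` over ℚ… — note
`ψ` is a character of conductor dividing `N`, quadratic only up to the cyclotomic twist; the congruence `a_p ≡ ψ(p) + p ψ(p)⁻¹` is the printed form).  REF2 placement: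
owed.
[cite: Silverman2009, III.8.6 and V.2.3.1]
[cite: Serre1972, §5]) -/
def ModThreeReducibleTraceVanishing : Prop :=
  ∀ (W : WeierstrassCurve ℚ) [W.IsElliptic] [W.IsGloballyMinimal], ¬ W.HasIrreducibleModPGaloisRep 3 →
    ∀ p : ℕ, p.Prime → ¬ p ∣ W.conductorNorm ℤ → p % 3 = 2 → (3 : ℤ) ∣ W.frobeniusTrace p

/-- **ES-33G₃ `ThreeIsogenyTwistDividesCongruenceNumber`** (this lens; the census row): non-CM `W`, `9 ∣ N`, `ρ̄_{W,3}` reducible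
(a rational 3-isogeny), and every multiplicative prime `q ∥ N` satisfies `q ≡ 1 (mod 3)` (so `2 ∥ N` is excluded) ⟹ `3 ∣ congruenceNumber f_W`.
Census 64/64 non-CM (`3 ∣ m_E` for 62 of them); without the split clause 231/248.  Explains part of Watkins' (2002, §4) unexplained
excess of `3 ∣ m_E` at non-squarefree level.
(RIDER, typer: PLAIN `def` (the census row).  REF1 §301: **(G₃) SURVIVES** (kernel glue `threeIsogenyTwist_of_oddStabiliser`: (Gℓ) at `ℓ = 3` + (T), with
the two Jacobi lemmas `(−3/q) = ±1 ↔ q ≡ 1, 2 (mod 3)`; the split clause over ALL `q ∥ N` literally excludes `2 ∥ N` — Probe301 (5)); independent re-tally 64/64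
non-CM, `3 ∣ deg` for 62, no-split mutation 231/248 with exactly -es's 17 violators; all apparent violators over `ℓ = 3..13` are CM self-twists (excluded).  Nearest
print: Watkins 2002 §4 (empirical «another factor» for `3 ∣ m_E` at non-squarefree level, no mechanism).  REF2 placement: owed.
[cite: Watkins2002, §4]) -/
def ThreeIsogenyTwistDividesCongruenceNumber : Prop :=
  ∀ (W : WeierstrassCurve ℚ) [W.IsElliptic] [W.IsGloballyMinimal] [NeZero (W.conductorNorm ℤ)]
    (D : ModularParametrizationData W (W.conductorNorm ℤ)), ¬ W.HasCM → ¬ W.HasIrreducibleModPGaloisRep 3 →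
    3 ^ 2 ∣ W.conductorNorm ℤ →
    (∀ q : ℕ, q.Prime → q ∣ W.conductorNorm ℤ → ¬ q ^ 2 ∣ W.conductorNorm ℤ → q % 3 = 1) →
    (3 : ℤ) ∣ congruenceNumber D.f

/-! ## Addendum 5 (session 3, ENGINE 33N): the SHARP clause at 2 of the resolvent statement

ENGINE 33N computes the congruence number `r_tw` of `f` inside the saturated TWIST-FAMILY lattice `{f ⊗ χ_D : D ∈ G_N}` directly from
q-expansions; for `S₃`-image curves `v₂(r_tw) = a₀(N) + [resolvent clauses]` on 1 664 of 1 682 curves (never below), and 11 of the 18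
others are curves with `2 ∤ N`, `2` INERT in `K = ℚ(√m)` (`m ≡ 5 mod 8`) and `a_2` EVEN (supersingular at 2: 121d1 `a_2 = 2`, 225d1/e1,
361b1, 441e1/f1, 675g1/h1, 1161a1–d1 `a_2 = 0`) — there the clause at 2 of `ResolventTwistDividesCongruenceNumber` is not needed: in the
proof the prime `2 ∣ n` (to an odd power, `2` inert) contributes `a_{2^e} ≡ a_2^e ≡ 0 (mod 2)`.  The four 1323 violators of the clause-free
statement are ORDINARY at 2 (`a_2 = 1`).  So the sharp clause is «`2 ∤ N ⟹ (m ≡ 1 mod 8 ∨ 2 ∣ a_2)`; `2 ∥ N ⟹ m ≡ 1 mod 8`». -/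

/-- **ES-33A♯ (sharp clause at 2) `ResolventTwistDividesCongruenceNumberSharp`**: as `ResolventTwistDividesCongruenceNumber`, with the clause
at `2` weakened to: `2 ∤ N ⟹ m ≡ 1 (mod 8)` OR `a_2(W)` even (supersingular at 2); `2 ∥ N ⟹ m ≡ 1 (mod 8)`.  Implies the original
(`sharp_imp_resolvent`).  Census (ENGINE 33N twist-family lattice, S₃ image, N ≤ 1 500 partial): the 11 odd-level supersingular-at-2 curves with
inert resolvent all show the extra power of 2.
(RIDER, typer -ty g22: PLAIN `def` (theorem-grade TARGET, nothing asserted).  REF1-AUDIT §311 (-ref1 g23; Probe311 = crux workfile v5 41d37d025705b01d AS-IS + block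
`REF1_311`, 6 items, farm rc 0 · 0 warn · 0 sorry; control rc 1 at a planted false conjunct): **ES-33A♯ (R♯) SURVIVES, THEOREM-GRADE** — (R) `ResolventTwistDividesCongruenceNumber`
(§301) with its single clause at 2 `¬ 4 ∣ N → m % 8 = 1` replaced by `(¬ 2 ∣ N → m % 8 = 1 ∨ 2 ∣ a₂) ∧ (2 ∥ N → m % 8 = 1)`: exactly what the mod-4 resolvent-twist
congruence needs at the coefficient `a₂` («the honest form of the mechanism, not a data fit»: every quadratic twist is `≡ f (mod 2)`; the RESOLVENT twist `χ_m` is `≡ f (mod 4)`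
coefficientwise because `χ_m(p) = −1` exactly at Frobenius-transpositions, where `a_p` is even; at `p = 2 ∤ N` this needs `χ_m(2) = +1` or `a₂` even; at `2 ∥ N`, `a₂ = ±1`
forces `χ_m(2) = +1`); `W.frobeniusTrace 2` is the `a₂` of the globally minimal model and the clause only fires at `2 ∤ N` (good reduction).  Glue
`sharp_imp_resolvent_minimal` ((R♯) ⟹ (R) on globally minimal models) PROVED, in the kernel sibling.  INDEPENDENT RE-TALLY (REF1's own `a_p`, -es's s33 ainvs + ENGINE 33P
`v₂(r_W)`; optimal non-CM curves with mod-2 image `GL₂(𝔽₂)`, `N ≤ 1498`: 2 480 curves; `REF1-data/b311/tally311.py`): 57 satisfy ALL hypotheses, **0 violations** of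
`2^(a₀+1) ∣ r_W`, 32 of them admitted by the sharp clause ONLY (`2 ∤ N`, `m ≢ 1 (8)`, `a₂` even: 121d1, 225d1/e1, 361b1, 441e1/f1, 675g1/h1, 1089i1/j1/k1, 1161a1–d1,
1225a1/c1/d1/i1/j1, 1323c1/h1/i1/j1/n1/q1/r1/s1 (`m = 21`), 1369a1/d1/e1/f1 (`m = 37`) ⊇ -es's 11); the §301 violators of the clause-free form 1323e1/g1/k1/l1 (`a₂` odd) stay
excluded.  REF2 placement (R311c): theorem-grade PLAIN, like (R); owed.
[cite: Shimura1971, Prop. 3.64]) -/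
def ResolventTwistDividesCongruenceNumberSharp : Prop :=
  ∀ (W : WeierstrassCurve ℚ) [W.IsElliptic] [W.IsGloballyMinimal] [NeZero (W.conductorNorm ℤ)]
    (D : ModularParametrizationData W (W.conductorNorm ℤ)) (m : ℤ), ¬ W.HasCM → Squarefree m → m ≠ 1 →
    IsSquare ((m : ℚ) * W.Δ) →
    (∀ p : ℕ, p.Prime → p ≠ 2 → (p : ℤ) ∣ m → p ^ 2 ∣ W.conductorNorm ℤ) →
    (m % 4 = 3 → 2 ^ 4 ∣ W.conductorNorm ℤ) → (2 ∣ m → 2 ^ 6 ∣ W.conductorNorm ℤ) →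
    (∀ q : ℕ, q.Prime → q ≠ 2 → q ∣ W.conductorNorm ℤ → ¬ q ^ 2 ∣ W.conductorNorm ℤ → jacobiSym m q = 1) →
    (¬ 2 ∣ W.conductorNorm ℤ → m % 8 = 1 ∨ 2 ∣ W.frobeniusTrace 2) →
    (2 ∣ W.conductorNorm ℤ → ¬ 4 ∣ W.conductorNorm ℤ → m % 8 = 1) →
    2 ^ (squareLevelTwistRank (W.conductorNorm ℤ) + 1) ∣ congruenceNumber D.f

/-! ### 4-adic extra depth (ENGINE 33N): the non-split Cartan normaliser at level 4

Six S₃-image curves (two twist families: 216a1/216d1/432g1/432h1 with `j = -3072`, `m = -3`; 968a1/968c1 with `j = 1024`, `m = -11`)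
show `v₂(r_tw) = a₀ + 2`: on them `a_p ≡ 0 (mod 4)` for EVERY good prime `p` inert in `K = ℚ(√m)` (checked `p < 400`).  Group theory
(enumeration of `GL₂(ℤ/4)`): the subgroups with full `GL₂(𝔽₂)` quotient, surjective determinant and trace `≡ 0 (mod 4)` on every lift of a
transposition are exactly the subgroups of the four conjugates of `N(C_ns(4))`, the normaliser of the non-split Cartan at level 4 (order 24,
`N ∩ ker = {±1, ±1 + 2ω}`), whose non-trivial coset has trace `0`; so the trace hypothesis below says `im ρ̄_{E,4} ⊆ N(C_ns(4))` with
`K` the Cartan-coset field.  In the twist lattice the resolvent type then has `g_τ = gcd a_n ≡ 0 (mod 4)` (`a_{p^e} = a_p · (…)` for odd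
`e`), i.e. one more power of `2`. -/

/-- **ES-33I `NonsplitCartanFourTwistDividesCongruenceNumber`**: under the hypotheses of `ResolventTwistDividesCongruenceNumberSharp`, if in
addition `4 ∣ a_p(W)` for every good prime `p` with `(m/p) = -1` (equivalently `im ρ̄_{W,4} ⊆ N(C_ns(4))` with coset field `ℚ(√m)`), then
`2 ^ (a₀(N) + 2) ∣ r_W`.  Census (ENGINE 33N, S₃ image): 216a1, 216d1, 432g1, 432h1, 968a1, 968c1 = all curves with `v₂(r_tw) = a₀ + 2`.
(RIDER, typer -ty g22: PLAIN `def` (mechanism-grade candidate, nothing asserted; ported VERBATIM — the two riders below are NOT folded into the body).  REF1-AUDIT §311: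
**ES-33I SURVIVES WITH RIDERS.**  Docstring group theory VERIFIED by exhaustive enumeration (`REF1-data/b311/gl2z4.py`: `GL₂(ℤ/4)` has 234 subgroups; those with full
`GL₂(𝔽₂)` quotient, `det` onto `{±1}` and trace `≡ 0 (mod 4)` on every lift of a transposition number 16; the maximal ones are EXACTLY the 4 conjugates of `N(C_ns(4))`,
`|N ∩ ker| = 4`, traces on the non-Cartan coset `= {0}`).  Mechanism read: then `f ≡ f ⊗ χ_m (mod 8)` at good odd inert `p` (`2a_p ≡ 0 (8)`), composite `n` with `χ_m(n) = −1`
carry an inert prime to an odd power.  INDEPENDENT RE-TALLY (population as for (R♯)): 22 curves have the trace property (`4 ∣ a_p` at every good odd `p < 400` inert in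
`ℚ(√m)`); **10 satisfy ALL hypotheses — 216a1, 216d1, 432g1, 432h1, 968a1, 968c1 (-es's six) AND 1296a1, 1296b1, 1296h1, 1296j1 (`m = −1`, `N = 2⁴3⁴`, `a₀ = 2`,
`v₂(r_W) = 6`)** — 0 violations of `2^(a₀+2) ∣ r_W` (`v₂(r_W)` = 4,4,6,6,6,6,6,6,6,6 against `a₀+2` = 3,3,4,4,3,3,4,4,4,4).  R311b (census note, -es): the instance list is 10, not 6;
HYPOTHESIS MUTATION — CHEAPEST-FALSIFIER BOX: dropping the clauses at 2 admits **162a1, 162d1 (`N = 2·3⁴`), 338a1, 338b1 (`N = 2·13²`), `m = −1`, with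
`v₂(r_W) = 2 < a₀+2 = 3`** (excluded only by «`2 ∥ N ⟹ m ≡ 1 (8)`» and «`m ≡ 3 (4) ⟹ 16 ∣ N`»), so the 2-clauses are LOAD-BEARING (any proof must use them); 648a1/c1,
726b1/d1/g1/i1, 968b1/d1 are excluded but would satisfy the bound.  **R311a (BLIND SPOT at `p = 2`):** the kernel fact `jacobiSym m 2 ≠ −1` (every unit of `ZMod 2` is a
square; kernel sibling, REF1 block (3)) makes the trace hypothesis `jacobiSym m p = −1 → 4 ∣ a_p` VACUOUS at `p = 2`, so for `2 ∤ N` with `2` INERT in `ℚ(√m)` (`m ≡ 5 (8)`)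
the Prop admits `a₂ = ±2` where the stated mechanism gives only `f ≡ f ⊗ χ_m (mod 4)` — it then claims `+2` on the strength of nothing; the class {`S₃`, non-CM, `2 ∤ N`,
`m ≡ 5 (8)`, `a₂ = ±2`, trace property} is EMPTY for `N ≤ 1498`, so no counterexample is at hand; the honest form adds `(¬ 2 ∣ N → m % 8 = 5 → W.frobeniusTrace 2 = 0)`
(`4 ∣ a₂ ⟺ a₂ = 0` by Hasse) or a docstring reason why the class is empty — -es's call (a v2 of this row, if filed, is an APPEND under a new name, never an in-place edit).
REF2 placement (R311c): PLAIN, mechanism-grade (mod-8 twist congruence inside the twist lattice), not a Literature fact; owed.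
[cite: Shimura1971, Prop. 3.64]) -/
def NonsplitCartanFourTwistDividesCongruenceNumber : Prop :=
  ∀ (W : WeierstrassCurve ℚ) [W.IsElliptic] [W.IsGloballyMinimal] [NeZero (W.conductorNorm ℤ)]
    (D : ModularParametrizationData W (W.conductorNorm ℤ)) (m : ℤ), ¬ W.HasCM → Squarefree m → m ≠ 1 →
    IsSquare ((m : ℚ) * W.Δ) →
    (∀ p : ℕ, p.Prime → p ≠ 2 → (p : ℤ) ∣ m → p ^ 2 ∣ W.conductorNorm ℤ) →
    (m % 4 = 3 → 2 ^ 4 ∣ W.conductorNorm ℤ) → (2 ∣ m → 2 ^ 6 ∣ W.conductorNorm ℤ) →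
    (∀ q : ℕ, q.Prime → q ≠ 2 → q ∣ W.conductorNorm ℤ → ¬ q ^ 2 ∣ W.conductorNorm ℤ → jacobiSym m q = 1) →
    (¬ 2 ∣ W.conductorNorm ℤ → m % 8 = 1 ∨ 2 ∣ W.frobeniusTrace 2) →
    (2 ∣ W.conductorNorm ℤ → ¬ 4 ∣ W.conductorNorm ℤ → m % 8 = 1) →
    (∀ p : ℕ, p.Prime → ¬ p ∣ W.conductorNorm ℤ → jacobiSym m p = -1 → (4 : ℤ) ∣ W.frobeniusTrace p) →
    2 ^ (squareLevelTwistRank (W.conductorNorm ℤ) + 2) ∣ congruenceNumber D.f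

/-! ### REF1 §311 riders R311a/b (-es g25, v6): the blind spot of ES-33I at the prime 2

Mathlib's `jacobiSym m 2` is never `-1` (tree: `jacobiSym_two_ne_neg_one`, `F1Sign2/ANg25` kernel), so the trace hypothesis of
`NonsplitCartanFourTwistDividesCongruenceNumber` (`jacobiSym m p = -1 → 4 ∣ a_p`) says nothing at `p = 2`.  When `2 ∤ N` and `m ≡ 5 (mod 8)`
the prime `2` is inert in `ℚ(√m)` and the `N(C_ns(4))` mechanism (non-trivial Cartan coset has trace `0 mod 4`) needs `a₂ ≡ 0 (mod 4)`, i.e.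
`a₂ = 0` since `|a₂| ≤ 2√2`; ES-33I as typed only asks `2 ∣ a₂` there (REF1 §311 R311a).  The sharp form below adds exactly that clause. -/

/-- **ES-33I♯ `NonsplitCartanFourTwistDividesCongruenceNumberSharp`** (-es g25, answering REF1 §311 R311a/b): ES-33I with the clause
`(¬ 2 ∣ N → m ≡ 5 (mod 8) → a₂(W) = 0)` closing the blind spot at the inert prime `2`.  Census (REF1 b311 independent re-tally + ENGINE 33N,
`S₃` image, `N ≤ 1 498`): the class `2 ∤ N, m ≡ 5 (8)` is EMPTY; TEN curves satisfy all hypotheses — 216a1, 216d1, 432g1, 432h1 (`m = -3`),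
968a1, 968c1 (`m = -11`), 1296a1, 1296b1, 1296h1, 1296j1 (`m = -1`, `a₀ = 2`, `v₂(r_W) = 6`) — with `2^(a₀+2) ∣ r_W` in all ten, 0 violations.
Falsifier box (REF1 mutation witnesses): dropping the two clauses at `2` admits 162a1, 162d1, 338a1, 338b1 (`m = -1`, `2 ∥ N`) with
`v₂(r_W) = 2 < a₀ + 2 = 3` — so those clauses are load-bearing.  Mechanism-grade PLAIN statement (REF2 R311c); not a theorem beyond print.
(RIDER, typer -ty g22: PLAIN `def` (mechanism-grade candidate, nothing asserted), VERBATIM from the crux workfile v6 (l.581–612, pure append over the §311/§316-gated v5);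
= ES-33I `NonsplitCartanFourTwistDividesCongruenceNumber` (above, kept as landed — rows are never edited in place) + EXACTLY REF1 §311 R311a's suggested clause
`(¬ 2 ∣ N → m % 8 = 5 → W.frobeniusTrace 2 = 0)` closing the `p = 2` blind spot (the trace hypothesis is vacuous at 2 — landed kernel fact `ANg25.Kernel.jacobiSym_two_ne_neg_one`);
the docstring carries R311b (instance list 10, falsifier box = REF1's mutation witnesses 162a1/d1, 338a1/b1).  Glue `nonsplitCartanFourSharp_of_nonsplit : ES-33I → ES-33I♯` (the sharp
form only ADDS a hypothesis) PROVED, in the kernel sibling v6.  REF1 §311 verdict on ES-33I carries over (SURVIVES; the class `2 ∤ N, m ≡ 5 (8)` is EMPTY for `N ≤ 1498`, so the new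
clause is untested-but-mechanism-forced); REF1-successor port gate owed (REF1 g23 FINAL 04:29Z).  REF2 placement (R311c): PLAIN, mechanism-grade; owed.
[cite: Shimura1971, Prop. 3.64]) -/
def NonsplitCartanFourTwistDividesCongruenceNumberSharp : Prop :=
  ∀ (W : WeierstrassCurve ℚ) [W.IsElliptic] [W.IsGloballyMinimal] [NeZero (W.conductorNorm ℤ)]
    (D : ModularParametrizationData W (W.conductorNorm ℤ)) (m : ℤ), ¬ W.HasCM → Squarefree m → m ≠ 1 →
    IsSquare ((m : ℚ) * W.Δ) →
    (∀ p : ℕ, p.Prime → p ≠ 2 → (p : ℤ) ∣ m → p ^ 2 ∣ W.conductorNorm ℤ) →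
    (m % 4 = 3 → 2 ^ 4 ∣ W.conductorNorm ℤ) → (2 ∣ m → 2 ^ 6 ∣ W.conductorNorm ℤ) →
    (∀ q : ℕ, q.Prime → q ≠ 2 → q ∣ W.conductorNorm ℤ → ¬ q ^ 2 ∣ W.conductorNorm ℤ → jacobiSym m q = 1) →
    (¬ 2 ∣ W.conductorNorm ℤ → m % 8 = 1 ∨ 2 ∣ W.frobeniusTrace 2) →
    (¬ 2 ∣ W.conductorNorm ℤ → m % 8 = 5 → W.frobeniusTrace 2 = 0) →
    (2 ∣ W.conductorNorm ℤ → ¬ 4 ∣ W.conductorNorm ℤ → m % 8 = 1) →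
    (∀ p : ℕ, p.Prime → ¬ p ∣ W.conductorNorm ℤ → jacobiSym m p = -1 → (4 : ℤ) ∣ W.frobeniusTrace p) →
    2 ^ (squareLevelTwistRank (W.conductorNorm ℤ) + 2) ∣ congruenceNumber D.f

end Summit.BirchSwinnertonDyer.BirchSwinnertonDyer.Theorems.RankOneAtTwoTwistLattice

end
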